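import Summits.QuantumFields.YangMills.Theorems.F4SubCurvatureDoorRationalToGeneralLinearApertureOf
import Summits.QuantumFields.YangMills.Theorems.F4SubCurvatureDoorRationalToGeneralQuantitativeCrossAnalyticity
import Summits.QuantumFields.YangMills.Theorems.F4SubCurvatureDoorRationalToGeneralPringsheimOfLukacs
import Summits.QuantumFields.YangMills.Theorems.F4SubCurvatureDoorForwardConeLukacsOneDim
import Summits.QuantumFields.YangMills.Theorems.F4SubCurvatureDoorRationalToGeneralConePinning
import Mathlib
import HarnessLib

/-!
# S1 programme (⟨stmt-QuantumFields-23125⟩) — rungs R-S1b `LinearAperture`, R-S1a `SpatialExponentialMoments` and «INITIAL APERTURE» BY NAME; `S1 ⇐ ApertureBootstrap`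

Crux `F4SubCurvatureDoor.RationalToGeneral` ⟨stmt-QuantumFields-23125⟩, owner file `Cruxes/RationalToGeneral/Lines/forward_cone_rungs.lean`
(ns `…ForwardConeRungs`, v5).  ASSEMBLY of the landed links of the S1 programme:

* `linearAperture_holds : LinearAperture` — `linearAperture_of` (this seat, p719004) fed with `directionalExtension_holds` (frs-p2 g15, p717588),
  `quantitativeCrossAnalyticity_holds` (frs-p2 g15, p719070) and `pringsheimIdentification_of_lukacsOneDim` (this seat, p720184) over w3 g37's
  Lukacs lemma `exists_expMoment_of_analyticAt_cosTransform` (p718973) — i.e. `PringsheimIdentification` by name (file `…PringsheimIdentification`);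
* `spatialExponentialMoments_holds : SpatialExponentialMoments` (R-S1a) — the case `δ = κt` of the linear aperture;
* `initialAperture_holds : InitialAperture` — the owner's glue `initialAperture_of_linearAperture` (rungs file v4, re-proved here verbatim because
  `Cruxes/` files are not importable) with `conePinning_holds` (frs-p2 g15, p717267): **every kernel of the C3 class has its Laplace–Fourier measure
  supported in a cone `E ≥ κ₀‖q⃗‖` with a UNIVERSAL `κ₀ > 0`**;
* `forwardConeSupport_of_apertureBootstrap : ApertureBootstrap → ForwardConeSupport` — the owner's supremum argument `forwardConeSupport_of_aperture`
  (rungs file v1, re-proved verbatim) applied to `initialAperture_holds`: the XL stub S1 of lines g21-A/B now hinges on the single typed statement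
  `ApertureBootstrap`.

`SpatialExponentialMoments`, `InitialAperture`, `ForwardConeSupport`, `ApertureBootstrap` are restated CHARACTER-IDENTICALLY; `LinearAperture` / `ConePinning` are the landed constants.
HONEST LABEL: assembly of rungs of the OPEN stub S1 (`ApertureBootstrap` is OPEN and is the several-complex-variables heart); nothing of S1, ⟨23125⟩,
⟨23035⟩, R2d is proved and the Yang–Mills mass gap is NOT proved; no summit is proved by a line.  Lead seat `ym-line-sfw-p2` g75 (cell ym-idea-1, free
hands); the two re-proved glue theorems are the owner's (planner ym-idea-3 g21).
-/

set_option autoImplicit false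

noncomputable section

open MeasureTheory Filter Topology Set Metric
open scoped BigOperators

namespace Summit.QuantumFields.YangMills.Theorems.F4SubCurvatureDoorInitialApertureRegistered

open Summit.QuantumFields.YangMills.Theorems.F4SubCurvatureDoorLaplaceFourierRegistered (E4 E3 InClass timeSpace IsLF)
open Summit.QuantumFields.YangMills.Theorems.F4SubCurvatureDoorLinearApertureOfRegistered (LinearAperture linearAperture_of)
open Summit.QuantumFields.YangMills.Theorems.F4SubCurvatureDoorDirectionalExtensionRegistered (directionalExtension_holds)
open Summit.QuantumFields.YangMills.Theorems.F4SubCurvatureDoorQuantitativeCrossAnalyticityRegistered (quantitativeCrossAnalyticity_holds)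
open Summit.QuantumFields.YangMills.Theorems.F4SubCurvatureDoorPringsheimOfLukacsRegistered (pringsheimIdentification_of_lukacsOneDim)
open Summit.QuantumFields.YangMills.Theorems.F4SubCurvatureDoorForwardConeLukacs (exists_expMoment_of_analyticAt_cosTransform)
open Summit.QuantumFields.YangMills.Theorems.F4SubCurvatureDoorConePinningRegistered (ConePinning conePinning_holds)
open Summit.QuantumFields.YangMills.Theorems.F4SubCurvatureDoorFibreDichotomyAxis (norm_timeSpace_zero)

/-! ## The Props (character-identical with `Lines/forward_cone_rungs.lean`) -/

/-- Stub S1 «FORWARD-CONE SUPPORT» (verbatim from `Lines/shell_separation.lean` / `Lines/fibre_dichotomy.lean`). -/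
def ForwardConeSupport : Prop :=
  ∀ K : E4 → ℝ, InClass K → ∀ μ : Measure (ℝ × E3), IsLF K μ → μ {p | p.1 < ‖p.2‖} = 0


/-- «INITIAL APERTURE» (= R-S1b + R-S1c + boundedness of the axis function outside the unit ball): a universal cone `E ≥ κ₀ |q⃗|`. -/
def InitialAperture : Prop :=
  ∃ κ : ℝ, 0 < κ ∧ ∀ (K : E4 → ℝ) (μ : Measure (ℝ × E3)), InClass K → IsLF K μ → μ {p | p.1 < κ * ‖p.2‖} = 0

/-- R-S1d «APERTURE BOOTSTRAP» (L; the several-complex-variables heart — 4-D analogue of `angular_type`'s equal-aperture edge bootstrap S3): a cone of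
aperture `κ < 1` valid for EVERY class kernel improves to some `κ' > κ` (the 24 frame tubes of aperture `κ` have an envelope of holomorphy containing the
frame tubes of aperture `κ'`; then Lukacs + pinning as in R-S1a–c).  WHY IT MIGHT FAIL: the envelope gain `κ' − κ` could vanish before `κ = 1` only if a
`W(F₄)`-symmetric, RP, non-Lorentzian dispersion existed — which is what S1 denies; honest open point. -/
def ApertureBootstrap : Prop :=
  ∀ κ : ℝ, 0 < κ → κ < 1 → ∃ κ' : ℝ, κ < κ' ∧
    ∀ (K : E4 → ℝ) (μ : Measure (ℝ × E3)), InClass K → IsLF K μ →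
      μ {p | p.1 < κ * ‖p.2‖} = 0 → μ {p | p.1 < κ' * ‖p.2‖} = 0


/-- R-S1a «SPATIAL EXPONENTIAL MOMENTS» (M–L; cross theorem at the time axis + multivariate Lukacs). -/
def SpatialExponentialMoments : Prop :=
  ∀ (K : E4 → ℝ) (μ : Measure (ℝ × E3)), InClass K → IsLF K μ →
    ∀ t : ℝ, 0 < t → ∃ δ : ℝ, 0 < δ ∧ Integrable (fun p : ℝ × E3 => Real.exp (-(t * p.1) + δ * ‖p.2‖)) μ

/-! ## R-S1b and R-S1a by name -/

/-- **RUNG R-S1b (by name): `LinearAperture`** — the glue `linearAperture_of` fed with the three landed rungs. -/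
theorem linearAperture_holds : LinearAperture :=
  linearAperture_of directionalExtension_holds (fun v hv => quantitativeCrossAnalyticity_holds v hv)
    (fun μ t ρ M ht hρ hint hG => pringsheimIdentification_of_lukacsOneDim
      (fun m hm φ hφ hA => by haveI := hm; exact exists_expMoment_of_analyticAt_cosTransform m φ hφ hA) μ t ρ M ht hρ hint hG)

/-- **RUNG R-S1a (by name): `SpatialExponentialMoments`** — the linear aperture `δ = κt` is an exponential moment. -/
theorem spatialExponentialMoments_holds : SpatialExponentialMoments := by
  obtain ⟨κ, c, C₀, hκ, -, -, h⟩ := linearAperture_holds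
  intro K μ hK hμ t ht
  refine ⟨κ * t, mul_pos hκ ht, ?_⟩
  exact (h K μ hK hμ t ht).1

/-! ## The owner's glue `LinearAperture → ConePinning → InitialAperture` (rungs file v4, planner ym-idea-3 g21), re-proved verbatim -/

/-- **PROVED GLUE**: the linear aperture with axis bound, cone pinning and the class's boundedness outside the unit ball give a universal
initial aperture.  With `forwardConeSupport_of_aperture`: `S1 ⇐ LinearAperture ∧ ConePinning ∧ ApertureBootstrap`. -/
theorem initialAperture_of_linearAperture (hL : LinearAperture) (hP : ConePinning) : InitialAperture := by
  obtain ⟨κ, c, C₀, hκ, hc, hC₀, h⟩ := hL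
  refine ⟨κ, hκ, fun K μ hK hμ => ?_⟩
  obtain ⟨CK, hCK⟩ := hK.2.1
  refine hP μ κ hκ ⟨C₀ * CK, max 1 (1 / c), fun t ht => ?_⟩
  have ht1 : 1 ≤ t := le_trans (le_max_left _ _) ht
  have htpos : 0 < t := lt_of_lt_of_le one_pos ht1
  have hct : 1 ≤ c * t := by
    have : 1 / c ≤ t := le_trans (le_max_right _ _) ht
    have h1 : 1 ≤ c * t := by
      have := mul_le_mul_of_nonneg_left this hc.le
      rwa [mul_one_div_cancel hc.ne'] at this
    exact h1
  obtain ⟨hint, hbound⟩ := h K μ hK hμ t htpos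
  refine ⟨hint, le_trans hbound ?_⟩
  have hnorm : 1 ≤ ‖timeSpace (c * t) 0‖ := by
    rw [norm_timeSpace_zero, abs_of_pos (mul_pos hc htpos)]; exact hct
  have hKle : K (timeSpace (c * t) 0) ≤ CK := le_trans (le_abs_self _) (hCK _ hnorm)
  exact mul_le_mul_of_nonneg_left hKle hC₀.le


/-- **«INITIAL APERTURE» (by name)**: a universal cone `E ≥ κ₀‖q⃗‖` carries every Laplace–Fourier measure of the class. -/
theorem initialAperture_holds : InitialAperture :=
  initialAperture_of_linearAperture linearAperture_holds conePinning_holds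

/-! ## The owner's supremum argument `InitialAperture → ApertureBootstrap → ForwardConeSupport` (rungs file v1, planner ym-idea-3 g21), re-proved verbatim -/

/-- Apertures pass to suprema: if every `κ' < κ⋆` (with `0 < κ'`) is an aperture of `μ`, so is `κ⋆`. -/
theorem aperture_of_forall_lt (μ : Measure (ℝ × E3)) (κs : ℝ)
    (h : ∀ κ' : ℝ, 0 < κ' → κ' < κs → μ {p | p.1 < κ' * ‖p.2‖} = 0) :
    μ {p : ℝ × E3 | p.1 < κs * ‖p.2‖} ≤ μ {p : ℝ × E3 | p.1 < 0} := by
  -- cover `{E < κ⋆|q⃗|}` by `{E < 0}` and the countable union over rational apertures below `κ⋆`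
  have hcov : {p : ℝ × E3 | p.1 < κs * ‖p.2‖} ⊆
      {p : ℝ × E3 | p.1 < 0} ∪ ⋃ (r : ℚ), {p : ℝ × E3 | 0 < (r : ℝ) ∧ (r : ℝ) < κs ∧ p.1 < (r : ℝ) * ‖p.2‖} := by
    intro p hp
    simp only [Set.mem_setOf_eq] at hp
    by_cases hneg : p.1 < 0
    · exact Or.inl hneg
    · right
      rw [not_lt] at hneg
      have hq : 0 < ‖p.2‖ := by
        rcases lt_or_eq_of_le (norm_nonneg p.2) with hlt | heq
        · exact hlt
        · exfalso; rw [← heq, mul_zero] at hp; linarith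
      have hks : p.1 / ‖p.2‖ < κs := by rwa [div_lt_iff₀ hq]
      obtain ⟨r, hr1, hr2⟩ := exists_rat_btwn (max_lt hks (show (0 : ℝ) < κs by
        have : 0 ≤ p.1 / ‖p.2‖ := div_nonneg hneg (le_of_lt hq); linarith))
      refine Set.mem_iUnion.mpr ⟨r, ?_⟩
      simp only [Set.mem_setOf_eq]
      refine ⟨lt_of_le_of_lt (le_max_right _ _) hr1, hr2, ?_⟩
      have h1 : p.1 / ‖p.2‖ < r := lt_of_le_of_lt (le_max_left _ _) hr1
      rwa [div_lt_iff₀ hq] at h1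
  calc μ {p : ℝ × E3 | p.1 < κs * ‖p.2‖}
      ≤ μ ({p : ℝ × E3 | p.1 < 0} ∪ ⋃ (r : ℚ), {p : ℝ × E3 | 0 < (r : ℝ) ∧ (r : ℝ) < κs ∧ p.1 < (r : ℝ) * ‖p.2‖}) :=
        measure_mono hcov
    _ ≤ μ {p : ℝ × E3 | p.1 < 0} + μ (⋃ (r : ℚ), {p : ℝ × E3 | 0 < (r : ℝ) ∧ (r : ℝ) < κs ∧ p.1 < (r : ℝ) * ‖p.2‖}) :=
        measure_union_le _ _
    _ ≤ μ {p : ℝ × E3 | p.1 < 0} + 0 := by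
        gcongr
        refine le_of_eq (measure_iUnion_null_iff.mpr fun r => ?_)
        by_cases hr : 0 < (r : ℝ) ∧ (r : ℝ) < κs
        · have := h r hr.1 hr.2
          refine measure_mono_null (fun p hp => ?_) this
          simp only [Set.mem_setOf_eq] at hp ⊢
          exact hp.2.2
        · refine measure_mono_null (fun p hp => ?_) (measure_empty (μ := μ))
          simp only [Set.mem_setOf_eq] at hp
          exact hr ⟨hp.1, hp.2.1⟩
    _ = μ {p : ℝ × E3 | p.1 < 0} := add_zero _

/-- A Laplace–Fourier measure has no negative energies. -/
theorem energy_nonneg_null (K : E4 → ℝ) (μ : Measure (ℝ × E3)) (hμ : IsLF K μ) :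
    μ {p : ℝ × E3 | p.1 < 0} = 0 := by
  have h := hμ.1
  have hset : {p : ℝ × E3 | p.1 < 0} = Set.Iio (0 : ℝ) ×ˢ (Set.univ : Set E3) := by
    ext p; simp [Set.mem_prod]
  rw [hset]; exact h

/-- **PROVED REDUCTION**: a universal initial aperture and the aperture bootstrap give S1 `ForwardConeSupport` (supremum argument). -/
theorem forwardConeSupport_of_aperture (h0 : InitialAperture) (hb : ApertureBootstrap) : ForwardConeSupport := by
  intro K hK μ hμ
  -- the set of universal apertures in (0, 1]
  set S : Set ℝ := {κ : ℝ | 0 < κ ∧ κ ≤ 1 ∧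
    ∀ (K' : E4 → ℝ) (μ' : Measure (ℝ × E3)), InClass K' → IsLF K' μ' → μ' {p | p.1 < κ * ‖p.2‖} = 0} with hS
  obtain ⟨κ₀, hκ₀, hA₀⟩ := h0
  -- `min κ₀ 1 ∈ S`
  have hmono : ∀ (κ₁ κ₂ : ℝ), κ₁ ≤ κ₂ → ∀ (μ' : Measure (ℝ × E3)),
      μ' {p | p.1 < κ₂ * ‖p.2‖} = 0 → μ' {p | p.1 < κ₁ * ‖p.2‖} = 0 := by
    intro κ₁ κ₂ hle μ' h2
    refine measure_mono_null (fun p hp => ?_) h2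
    simp only [Set.mem_setOf_eq] at hp ⊢
    exact lt_of_lt_of_le hp (mul_le_mul_of_nonneg_right hle (norm_nonneg _))
  have hmem : min κ₀ 1 ∈ S := by
    refine ⟨lt_min hκ₀ one_pos, min_le_right _ _, fun K' μ' hK' hμ' => ?_⟩
    exact hmono _ _ (min_le_left _ _) μ' (hA₀ K' μ' hK' hμ')
  have hne : S.Nonempty := ⟨_, hmem⟩
  have hbdd : BddAbove S := ⟨1, fun κ hκ => hκ.2.1⟩
  set κs := sSup S with hκs
  have hκs_le : κs ≤ 1 := csSup_le hne (fun κ hκ => hκ.2.1)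
  have hκs_pos : 0 < κs := lt_of_lt_of_le (lt_min hκ₀ one_pos) (le_csSup hbdd hmem)
  -- every κ' < κ⋆ with 0 < κ' is a universal aperture
  have hbelow : ∀ κ' : ℝ, 0 < κ' → κ' < κs →
      ∀ (K' : E4 → ℝ) (μ' : Measure (ℝ × E3)), InClass K' → IsLF K' μ' → μ' {p | p.1 < κ' * ‖p.2‖} = 0 := by
    intro κ' hκ' hlt K' μ' hK' hμ'
    obtain ⟨κ, hκS, hκ'κ⟩ := exists_lt_of_lt_csSup hne hlt
    exact hmono _ _ (le_of_lt hκ'κ) μ' (hκS.2.2 K' μ' hK' hμ')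
  -- hence κ⋆ itself is a universal aperture
  have hstar : ∀ (K' : E4 → ℝ) (μ' : Measure (ℝ × E3)), InClass K' → IsLF K' μ' →
      μ' {p | p.1 < κs * ‖p.2‖} = 0 := by
    intro K' μ' hK' hμ'
    have := aperture_of_forall_lt μ' κs (fun κ' hκ' hlt => hbelow κ' hκ' hlt K' μ' hK' hμ')
    rw [energy_nonneg_null K' μ' hμ'] at this
    exact le_antisymm this bot_le
  -- κ⋆ = 1, else the bootstrap contradicts maximality
  have hκs_one : κs = 1 := by
    by_contra hne1
    have hlt1 : κs < 1 := lt_of_le_of_ne hκs_le hne1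
    obtain ⟨κ', hκ', hA'⟩ := hb κs hκs_pos hlt1
    have hmem' : min κ' 1 ∈ S := by
      refine ⟨lt_min (lt_trans hκs_pos hκ') one_pos, min_le_right _ _, fun K' μ' hK' hμ' => ?_⟩
      exact hmono _ _ (min_le_left _ _) μ' (hA' K' μ' hK' hμ' (hstar K' μ' hK' hμ'))
    have : min κ' 1 ≤ κs := le_csSup hbdd hmem'
    have : κs < min κ' 1 := lt_min hκ' hlt1
    linarith
  have := hstar K μ hK hμ
  rw [hκs_one] at this
  simpa only [one_mul] using this

/-- **S1 ⇐ `ApertureBootstrap`**: with the initial aperture a theorem, the XL stub `ForwardConeSupport` of lines g21-A/B follows from the single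
typed statement `ApertureBootstrap`. -/
theorem forwardConeSupport_of_apertureBootstrap (hb : ApertureBootstrap) : ForwardConeSupport :=
  forwardConeSupport_of_aperture initialAperture_holds hb

end Summit.QuantumFields.YangMills.Theorems.F4SubCurvatureDoorInitialApertureRegistered

end
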